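import Summits.HodgeConjecture.CorCM.StabiliserOrbitCriterion
import Summits.HodgeConjecture.CorCM.ReflexSlotIncidence
import HarnessLib

/-!
# THE REFLEX SLOT AS A STABILISER ORBIT: with pair flips on the base, `Stab(x₀)` is transitive on the translates of the
# type containing `x₀`, and the one-orbit criterion reads on INCIDENCE NUMBERS

COR-CM (cell `pub-hodgecm2`, binder seat `b16` gen 53, count-neutral claim ORBIT-CRITERION, file F4a — abstract `G`-set
level; theorems only, no definition, no named fact, no `sorry`).  NEW as stated, hence under `Summits/`.  HONEST FRAMING:
finite-dimensional linear algebra about the Kubota–Dodson rank of pairs of CM types; `HC_CM` is neither used nor asserted.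

SETTING (gen 45 `ReflexSlotIncidence`).  `G` acts on the base slot `Z` (CM type `Φ₀` for `ρ`, PAIR FLIPS) and on the
reflex slot `Y`, with the type map `T : Y → Set Z` (`T(g y₀) = gΦ₀`: equivariant `x ∈ T(g y) ⟺ g⁻¹x ∈ T(y)`, injective,
`T y₀ = Φ₀`, `G` transitive on `Y`).  For CM fields: `Z = Hom(K₀, ℂ)`, `Y = Hom(K₁, ℂ)` with `ψ₀(K₁)` the reflex field of
`(K₀, Φ₀)` (sequel F4b `PairFlipCMFieldTimesReflexFieldHodge`).  The REFLEX TYPE at `x₀` is `Φ₀* = {y : x₀ ∈ T y}`; the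
INCIDENCE NUMBER of `Ψ ⊆ Y` at `x ∈ Z` is `N(x) = #{y ∈ Ψ : x ∈ T y}`.

* §1 `mem_typeMap_iff_exists_smul_base` (`x ∈ T y ⟺ ∃ g, g y₀ = y ∧ g⁻¹x ∈ Φ₀`), `mem_typeMap_or_mem_typeMap_rho_smul`
  (every `y` lies in `Φ₀*` or in `ρΦ₀*`: NO point off the orbit pair), **`exists_stab_smul_eq_of_mem_typeMap`** —
  `Stab(x₀)` is TRANSITIVE on `Φ₀*` (induction on the Hamming distance `#(T y ∖ T y')`: flip a pair where the two
  translates differ; it is never the pair of `x₀`, so the flip fixes `x₀`), `card_filter_mem_typeMap_smul_eq` (the orbit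
  multiplicities of `Φ₀*` are the incidence numbers: `#{y ∈ Φ₀* : g y ∈ Ψ} = N(g x₀)`).
* §2 **`typeRank_sigmaType_eq_iff_of_pairFlip_of_typeMap`** (F2's one-orbit criterion with `O = Φ₀*`): `I = {i₀, i₁}`, pair
  flips on `E_{i₀}`, `T` a type map on `E_{i₁}`: `Σ` is nondegenerate IFF `Φ_{i₁}` is nondegenerate AND the incidence
  numbers `N(x) = #{y ∈ Φ_{i₁} : x ∈ T y}` are NOT `a` on `Φ_{i₀}`, `b` off `Φ_{i₀}` with `a ≠ b`; rank form
  `typeRank_sigmaType_add_card_eq_iff_of_pairFlip_of_typeMap` (`Hg(A₀ × A₁) = Hg(A₀) × Hg(A₁)` IFF …);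
  `typeRank_sigmaType_add_card_lt_of_incidence` (constant unequal incidence ⟹ degenerate, no flips).  For `n = 3` pairs
  the exceptional `Φ_{i₁}` are gen 45's two Hamming balls (`PairFlipSexticReflexSlotBalls`), now in every degree.

## References

* [Dodson1984] B. Dodson, *The structure of Galois groups of CM-fields*, Trans. AMS 283 (1984), §1 (Reflex Degree
  Theorem and Remark), §1.1, §3.3.2, §5.1.2.
* [Shimura1998] G. Shimura, *Abelian Varieties with Complex Multiplication and Modular Functions*, §8.3 Prop. 28.
* [Gordon1999HodgeAVSurvey] B. B. Gordon, *A survey of the Hodge conjecture for abelian varieties*, §3 Theorem, 7.5–7.7,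
  9.4.3.
-/

set_option autoImplicit false

noncomputable section

open scoped BigOperators

universe u v

namespace Summit.HodgeConjecture.CorCM

namespace ReflexSlot

open Literature.NumberTheory.ComplexMultiplication
open scoped Classical

variable {G : Type u} [Group G]

/-! ### §1 The reflex slot: the stabiliser of a base point is transitive on the translates containing it -/

section Abstract

variable {Z Y : Type*} [MulAction G Z] [MulAction G Y] {ρ : G} {Φ₀ : Set Z} {T : Y → Set Z} {y₀ : Y}

/-- **Incidence through the base embedding**: `x ∈ T(y) ⟺ ∃ g, g y₀ = y ∧ g⁻¹ x ∈ Φ₀` (`T(g y₀) = gΦ₀`).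
[cite: Shimura1998, §8.3 Prop. 28] [cite: Dodson1984, §1 (Remark after the Reflex Degree Theorem)] -/
theorem mem_typeMap_iff_exists_smul_base (hT : ∀ (g : G) (y : Y) (x : Z), x ∈ T (g • y) ↔ g⁻¹ • x ∈ T y)
    (hT₀ : T y₀ = Φ₀) (hY : ∀ y : Y, ∃ g : G, g • y₀ = y) (x : Z) (y : Y) :
    x ∈ T y ↔ ∃ g : G, g • y₀ = y ∧ g⁻¹ • x ∈ Φ₀ := by
  constructor
  · intro hx
    obtain ⟨g, rfl⟩ := hY y
    exact ⟨g, rfl, (mem_typeMap_smul_base_iff hT hT₀ g x).1 hx⟩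
  · rintro ⟨g, rfl, hg⟩
    exact (mem_typeMap_smul_base_iff hT hT₀ g x).2 hg

/-- **No point off the orbit pair**: every `y` has `x₀ ∈ T(y)` or `x₀ ∈ T(ρy) = Z ∖ T(y)`.
[cite: Shimura1998, §8.3 Prop. 28] -/
theorem mem_typeMap_or_mem_typeMap_rho_smul (hΦ : IsCMTypeWith ρ Φ₀)
    (hT : ∀ (g : G) (y : Y) (x : Z), x ∈ T (g • y) ↔ g⁻¹ • x ∈ T y) (hT₀ : T y₀ = Φ₀)
    (hY : ∀ y : Y, ∃ g : G, g • y₀ = y) (x₀ : Z) (y : Y) : x₀ ∈ T y ∨ x₀ ∈ T (ρ • y) := by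
  by_cases h : x₀ ∈ T y
  · exact Or.inl h
  · exact Or.inr ((mem_typeMap_rho_smul_iff hΦ hT hT₀ hY y x₀).2 h)

/-- **`Stab(x₀)` is transitive on the translates containing `x₀`** when the base has pair flips: two points `y, y'` with
`x₀ ∈ T(y) ∩ T(y')` differ by a product of flips at points `x ∉ {x₀, ρx₀}` (induction on `#(T y ∖ T y')`), and such a
product fixes `x₀`. [cite: Dodson1984, §1.1 and §5.1.2] -/
theorem exists_stab_smul_eq_of_mem_typeMap [Fintype Z] (hΦ : IsCMTypeWith ρ Φ₀)
    (hT : ∀ (g : G) (y : Y) (x : Z), x ∈ T (g • y) ↔ g⁻¹ • x ∈ T y) (hTi : Function.Injective T)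
    (hT₀ : T y₀ = Φ₀) (hY : ∀ y : Y, ∃ g : G, g • y₀ = y)
    (hflip : ∀ x : Z, ∃ φ : G, φ • x = ρ • x ∧ ∀ x' : Z, x' ≠ x → x' ≠ ρ • x → φ • x' = x')
    {x₀ : Z} {y y' : Y} (hy : x₀ ∈ T y) (hy' : x₀ ∈ T y') : ∃ g : G, g • x₀ = x₀ ∧ g • y = y' := by
  suffices key : ∀ (n : ℕ) (y : Y), (Finset.univ.filter fun x : Z => x ∈ T y ∧ x ∉ T y').card = n →
      x₀ ∈ T y → ∃ g : G, g • x₀ = x₀ ∧ g • y = y' from key _ y rfl hy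
  intro n
  induction n with
  | zero =>
    intro y hcard _
    refine ⟨1, one_smul _ _, ?_⟩
    rw [one_smul]
    have hnone : ∀ x : Z, ¬ (x ∈ T y ∧ x ∉ T y') := by
      intro x hx
      have hmem : x ∈ (Finset.univ.filter fun x : Z => x ∈ T y ∧ x ∉ T y') := by
        rw [Finset.mem_filter]
        exact ⟨Finset.mem_univ _, hx⟩
      rw [Finset.card_eq_zero] at hcard
      rw [hcard] at hmem
      exact Finset.notMem_empty _ hmem
    apply hTi
    ext x
    constructor
    · intro hx
      by_contra hx'
      exact hnone x ⟨hx, hx'⟩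
    · intro hx'
      by_contra hx
      exact hnone (ρ • x) ⟨(rho_smul_mem_typeMap_iff hΦ hT hT₀ hY y x).2 hx,
        fun h => (rho_smul_mem_typeMap_iff hΦ hT hT₀ hY y' x).1 h hx'⟩
  | succ n ih =>
    intro y hcard hy
    obtain ⟨x, hx⟩ : (Finset.univ.filter fun x : Z => x ∈ T y ∧ x ∉ T y').Nonempty := by
      rw [← Finset.card_pos, hcard]
      exact Nat.succ_pos n
    have hxmem := hx
    rw [Finset.mem_filter] at hx
    obtain ⟨-, hxy, hxy'⟩ := hx
    obtain ⟨φ, hφx, hφ⟩ := hflip x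
    have hρx_y : ρ • x ∉ T y := fun h => (rho_smul_mem_typeMap_iff hΦ hT hT₀ hY y x).1 h hxy
    have hρx_y' : ρ • x ∈ T y' := (rho_smul_mem_typeMap_iff hΦ hT hT₀ hY y' x).2 hxy'
    have hx₀x : x₀ ≠ x := fun h => hxy' (h ▸ hy')
    have hx₀ρx : x₀ ≠ ρ • x := fun h => hρx_y (h ▸ hy)
    -- coordinates of `φ • y`
    have hcoord : ∀ x' : Z, x' ≠ x → x' ≠ ρ • x → (x' ∈ T (φ • y) ↔ x' ∈ T y) := fun x' h1 h2 =>
      mem_typeMap_smul_iff_of_smul_eq hT (hφ x' h1 h2) y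
    have hcx : x ∉ T (φ • y) := fun h =>
      (mem_typeMap_smul_iff_of_smul_rho_eq hΦ hT hT₀ hY (smul_rho_eq_of_pairFlip hΦ hφx) y).1 h hxy
    have hcρx : ρ • x ∈ T (φ • y) := by
      have hφρ : φ • ρ • (ρ • x) = ρ • x := by rw [hΦ.invol, hφx]
      exact (mem_typeMap_smul_iff_of_smul_rho_eq hΦ hT hT₀ hY hφρ y).2 hρx_y
    -- the difference set loses exactly the point `x`
    have hD : (Finset.univ.filter fun x' : Z => x' ∈ T (φ • y) ∧ x' ∉ T y') =
        (Finset.univ.filter fun x' : Z => x' ∈ T y ∧ x' ∉ T y').erase x := by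
      ext x'
      simp only [Finset.mem_erase, Finset.mem_filter, Finset.mem_univ, true_and]
      by_cases h1 : x' = x
      · subst h1
        exact ⟨fun h => absurd h.1 hcx, fun h => absurd rfl h.1⟩
      · by_cases h2 : x' = ρ • x
        · subst h2
          exact ⟨fun h => absurd hρx_y' h.2, fun h => absurd h.2.1 hρx_y⟩
        · rw [hcoord x' h1 h2]
          exact ⟨fun h => ⟨h1, h⟩, fun h => h.2⟩
    have hcard' : (Finset.univ.filter fun x' : Z => x' ∈ T (φ • y) ∧ x' ∉ T y').card = n := by
      rw [hD, Finset.card_erase_of_mem hxmem, hcard]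
      rfl
    have hy₁ : x₀ ∈ T (φ • y) := (hcoord x₀ hx₀x hx₀ρx).2 hy
    obtain ⟨g', hg'x, hg'y⟩ := ih (φ • y) hcard' hy₁
    refine ⟨g' * φ, ?_, ?_⟩
    · rw [mul_smul, hφ x₀ hx₀x hx₀ρx, hg'x]
    · rw [mul_smul, hg'y]

/-- **Orbit multiplicities of the reflex type are incidence numbers**: `#{y : x₀ ∈ T y, g y ∈ Ψ} = #{y ∈ Ψ : g x₀ ∈ T y}`
(translate by `g`). [cite: Dodson1984, §1 (Remark after the Reflex Degree Theorem)] -/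
theorem card_filter_mem_typeMap_smul_eq [Fintype Y]
    (hT : ∀ (g : G) (y : Y) (x : Z), x ∈ T (g • y) ↔ g⁻¹ • x ∈ T y) (x₀ : Z) (Ψ : Set Y) (g : G) :
    (Finset.univ.filter fun y : Y => y ∈ {y : Y | x₀ ∈ T y} ∧ g • y ∈ Ψ).card =
      (Finset.univ.filter fun y : Y => y ∈ Ψ ∧ g • x₀ ∈ T y).card := by
  refine Finset.card_equiv (MulAction.toPerm g) fun y => ?_
  simp only [Finset.mem_filter, Finset.mem_univ, true_and, MulAction.toPerm_apply, Set.mem_setOf_eq]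
  have h : g • x₀ ∈ T (g • y) ↔ x₀ ∈ T y := by rw [hT, inv_smul_smul]
  rw [h]
  exact And.comm

end Abstract

/-! ### §2 Families: the criterion for a pair-flip base against its reflex slot -/

section Family

variable {I : Type v} {E : I → Type v} [∀ i, MulAction G (E i)] [DecidableEq I] [Fintype I] [∀ i, Fintype (E i)]
  {ρ : G} {Φ : ∀ i, Set (E i)} {i₀ i₁ : I} [Nonempty I] [∀ i, Nonempty (E i)]
  {T : E i₁ → Set (E i₀)} {y₀ : E i₁}

/-- **THE REFLEX-SLOT CRITERION (nondegeneracy form).**  `I = {i₀, i₁}`, pair flips on the base slot `E_{i₀}` (type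
`Φ_{i₀}`), `T : E_{i₁} → Set E_{i₀}` the type map of a reflex slot (`T(g y₀) = gΦ_{i₀}`, injective, `G` transitive on
`E_{i₁}`): `Σ` is nondegenerate IFF `Φ_{i₁}` is nondegenerate AND the incidence numbers `#{y ∈ Φ_{i₁} : x ∈ T y}` are NOT
`a` on `Φ_{i₀}`, `b` off `Φ_{i₀}` with `a ≠ b`. [cite: Gordon1999HodgeAVSurvey, §3 Theorem, 7.5–7.7 and 9.4.3]
[cite: Dodson1984, §1.1, §3.3.2 and §5.1.2] -/
theorem typeRank_sigmaType_eq_iff_of_pairFlip_of_typeMap [MulAction.IsPretransitive G (E i₀)]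
    (h : ∀ i, IsCMTypeWith ρ (Φ i)) (hI : ∀ j, j = i₀ ∨ j = i₁) (h01 : i₀ ≠ i₁)
    (hflip : ∀ x : E i₀, ∃ φ : G, φ • x = ρ • x ∧ ∀ x' : E i₀, x' ≠ x → x' ≠ ρ • x → φ • x' = x')
    (hT : ∀ (g : G) (y : E i₁) (x : E i₀), x ∈ T (g • y) ↔ g⁻¹ • x ∈ T y) (hTi : Function.Injective T)
    (hT₀ : T y₀ = Φ i₀) (hY : ∀ y : E i₁, ∃ g : G, g • y₀ = y) :
    typeRank G (sigmaType Φ) = Fintype.card (Σ i, E i) / 2 + 1 ↔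
      typeRank G (Φ i₁) = Fintype.card (E i₁) / 2 + 1 ∧
        ¬ ∃ a b : ℕ, a ≠ b ∧ ∀ x : E i₀,
          (Finset.univ.filter fun y : E i₁ => y ∈ Φ i₁ ∧ x ∈ T y).card = if x ∈ Φ i₀ then a else b := by
  obtain ⟨x₀⟩ := (inferInstance : Nonempty (E i₀))
  have hO : ∀ y ∈ {y : E i₁ | x₀ ∈ T y}, ∀ y' ∈ {y : E i₁ | x₀ ∈ T y}, ∃ g : G, g • x₀ = x₀ ∧ g • y = y' :=
    fun y hy y' hy' => exists_stab_smul_eq_of_mem_typeMap (h i₀) hT hTi hT₀ hY hflip hy hy'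
  have hoff : ∀ y : E i₁, y ∉ {y : E i₁ | x₀ ∈ T y} → ρ • y ∉ {y : E i₁ | x₀ ∈ T y} →
      ∃ σ : G, σ • x₀ = ρ • x₀ ∧ σ • y = y :=
    fun y hy hρy => ((mem_typeMap_or_mem_typeMap_rho_smul (h i₀) hT hT₀ hY x₀ y).elim hy hρy).elim
  rw [Shadow.typeRank_sigmaType_eq_iff_of_pairFlip_of_orbit h hI h01 hflip {y : E i₁ | x₀ ∈ T y} hO hoff]
  refine and_congr Iff.rfl (not_congr (exists_congr fun a => exists_congr fun b => and_congr Iff.rfl ?_))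
  constructor
  · intro hg x
    obtain ⟨g, rfl⟩ := MulAction.exists_smul_eq G x₀ x
    rw [← card_filter_mem_typeMap_smul_eq hT x₀ (Φ i₁) g]
    exact hg g
  · intro hx g
    exact (card_filter_mem_typeMap_smul_eq hT x₀ (Φ i₁) g).trans (hx (g • x₀))

/-- **THE REFLEX-SLOT CRITERION (rank form)**: `rank(Σ) + |I| = Σ_i rank(Φ_i) + 1` (`Hg(A₀ × A₁) = Hg(A₀) × Hg(A₁)`) IFF
the incidence numbers are not constant-unequal. [cite: Gordon1999HodgeAVSurvey, §3 Theorem (1), 7.5–7.7 and 9.4.3]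
[cite: Dodson1984, §5.1.2] -/
theorem typeRank_sigmaType_add_card_eq_iff_of_pairFlip_of_typeMap [MulAction.IsPretransitive G (E i₀)]
    (h : ∀ i, IsCMTypeWith ρ (Φ i)) (hI : ∀ j, j = i₀ ∨ j = i₁) (h01 : i₀ ≠ i₁)
    (hflip : ∀ x : E i₀, ∃ φ : G, φ • x = ρ • x ∧ ∀ x' : E i₀, x' ≠ x → x' ≠ ρ • x → φ • x' = x')
    (hT : ∀ (g : G) (y : E i₁) (x : E i₀), x ∈ T (g • y) ↔ g⁻¹ • x ∈ T y) (hTi : Function.Injective T)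
    (hT₀ : T y₀ = Φ i₀) (hY : ∀ y : E i₁, ∃ g : G, g • y₀ = y) :
    typeRank G (sigmaType Φ) + Fintype.card I = (∑ i, typeRank G (Φ i)) + 1 ↔
      ¬ ∃ a b : ℕ, a ≠ b ∧ ∀ x : E i₀,
        (Finset.univ.filter fun y : E i₁ => y ∈ Φ i₁ ∧ x ∈ T y).card = if x ∈ Φ i₀ then a else b := by
  obtain ⟨x₀⟩ := (inferInstance : Nonempty (E i₀))
  have hO : ∀ y ∈ {y : E i₁ | x₀ ∈ T y}, ∀ y' ∈ {y : E i₁ | x₀ ∈ T y}, ∃ g : G, g • x₀ = x₀ ∧ g • y = y' :=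
    fun y hy y' hy' => exists_stab_smul_eq_of_mem_typeMap (h i₀) hT hTi hT₀ hY hflip hy hy'
  have hoff : ∀ y : E i₁, y ∉ {y : E i₁ | x₀ ∈ T y} → ρ • y ∉ {y : E i₁ | x₀ ∈ T y} →
      ∃ σ : G, σ • x₀ = ρ • x₀ ∧ σ • y = y :=
    fun y hy hρy => ((mem_typeMap_or_mem_typeMap_rho_smul (h i₀) hT hT₀ hY x₀ y).elim hy hρy).elim
  rw [Shadow.typeRank_sigmaType_add_card_eq_iff_not_exists_orbitMultiplicities h hI h01
    (antiSpan_irreducible_of_pairFlip (h i₀) hflip) {y : E i₁ | x₀ ∈ T y} hO hoff]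
  refine not_congr (exists_congr fun a => exists_congr fun b => and_congr Iff.rfl ?_)
  constructor
  · intro hg x
    obtain ⟨g, rfl⟩ := MulAction.exists_smul_eq G x₀ x
    rw [← card_filter_mem_typeMap_smul_eq hT x₀ (Φ i₁) g]
    exact hg g
  · intro hx g
    exact (card_filter_mem_typeMap_smul_eq hT x₀ (Φ i₁) g).trans (hx (g • x₀))

omit [DecidableEq I] in
/-- **Constant unequal incidence numbers make the pair degenerate** (no flip hypothesis): `rank(Σ) + |I| < Σ_i rank(Φ_i) + 1`.
[cite: Gordon1999HodgeAVSurvey, §3 Theorem (proof), 7.5 and 9.4.3] -/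
theorem typeRank_sigmaType_add_card_lt_of_incidence (h : ∀ i, IsCMTypeWith ρ (Φ i)) (h01 : i₀ ≠ i₁)
    (hT : ∀ (g : G) (y : E i₁) (x : E i₀), x ∈ T (g • y) ↔ g⁻¹ • x ∈ T y) {a b : ℕ} (hab : a ≠ b)
    (hN : ∀ x : E i₀, (Finset.univ.filter fun y : E i₁ => y ∈ Φ i₁ ∧ x ∈ T y).card = if x ∈ Φ i₀ then a else b) :
    typeRank G (sigmaType Φ) + Fintype.card I < (∑ i, typeRank G (Φ i)) + 1 := by
  obtain ⟨x₀⟩ := (inferInstance : Nonempty (E i₀))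
  exact Shadow.typeRank_sigmaType_add_card_lt_of_orbitMultiplicities h h01 (x₀ := x₀) {y : E i₁ | x₀ ∈ T y} hab
    fun g => (card_filter_mem_typeMap_smul_eq hT x₀ (Φ i₁) g).trans (hN (g • x₀))

end Family

end ReflexSlot

end Summit.HodgeConjecture.CorCM

end
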